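import Summits.Ventures.LatticeQCDFlow.Scaling.HubChainSeparableForm

/-!
HONEST FRAMING: exact (Metropolis-corrected) sampling algorithms for lattice gauge theory; figures
of merit are autocorrelation/cost numbers at stated couplings and volumes; no continuum-physics
claim.

# HubChainPerStepDomination — CONJECTURE M′ SETTLED: FOR THE HUB CHAIN OF THE STAR (CHAPTER W'S CLASS CHAIN `Kh`, AND THE LABELLED CHAIN), RAISING THE DEPTH OF ONE RANK `s` LOWERS
# THE `n`-STEP TRANSITION PROBABILITY `Pⁿ(i,j)` FOR EVERY `n` AND EVERY PAIR OF DISTINCT RANKS `i, j` OFF THE TAG — IN EVERY RELATIVE POSITION OF `i, j, s` (lean-2 GEN-40, ours)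

Venture-side (OURS).  Cell `lqcd-flow` (pub-lqcd), unit `pub-lqcd-lean-2-g40`, 2026-08-30.  Chapter Z, file 2.  Setting of chapter Y for TWO depth profiles `ρ^X, ρ^Y > 0` (both non-decreasing in
the rank) agreeing off one rank `s` with `ρ^X_s ≤ ρ^Y_s`, common class weights `N > 0` (`M_k = Σ_{i≥k}N_i`), `R_k = Σ_{i<k}N_iρ_i`, `β_k = 1 − c(M_k + R_k/ρ_k)`, the Smith–Tierney functions
`T^X, T^Y` of Y8 and the depth-free levels `a_l = 1 − cM_{l+1}` of file Z1.  By the rank-separable form (Z1 `hubClass_T_separable`)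

  `T_n(j) = cW_j·H_n(β_j,a_j) + c·Σ_{l>j}W_l·[H_n(β_l,a_l) − H_n(β_l,a_{l−1})]`,  rank term `= cN_lW_l·G_n(a_l,a_{l−1},β_l)·c = (cN_l/R_l)[H_n(a_{l−1},a_l) − H_n(β_l,a_l)]`,

raising `ρ_s` (i) raises `β_s` with `R_s` FIXED — the rank-`s` term falls in its `R`-face; (ii) lowers every `β_l`, `l > s`, with `W_l` FIXED — those terms fall in their `G`-face; (iii) moves
nothing else.  The only analytic input is Y6's `geomPartial_mono` (`Σ_{t<n}yᵗ` non-decreasing on `[−½,∞)`), usable at rank `l` as soon as `β_l ≥ −a_l/2`, which holds whenever at least three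
particles sit at depth `≤ ρ_l` (`M_{l+1} + 3 ≤ M_0`) and `c·M_0 ≤ 1 + c` (`c ≤ 1/K` for `K+1` particles):

* `perStep_T_le_deep`: `s < j`, `M_{j+1} + 3 ≤ M_0` ⇒ `T^Y_n(j) ≤ T^X_n(j)` for every `n` (deep target — NO sign condition on `β_j`, superseding Y10);
* `perStep_T_le_shallow`: `j < s`, `M_{s+1} + 3 ≤ M_0` ⇒ `T^Y_n(j) ≤ T^X_n(j)` for every `n` (tag deeper than the target, ANY position of the tag, superseding Y6);
* **`perStep_pow_le`**: for ranks `i ≠ j`, both `≠ s`, with `M_{k+1} + 3 ≤ M_0` at `k = max(i,j,s)`: **`P_Yⁿ(i,j) ≤ P_Xⁿ(i,j)` for every `n`**; `perStep_pow_diag_le`: the diagonal at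
  starts shallower than the tag;
* LABELLED CHAIN (`N ≡ 1`, `m = K+1` particles, `c(m−1) ≤ 1`): **`perStep_labelled_pow_le`: `P_Yⁿ(i,j) ≤ P_Xⁿ(i,j)` for every `n` and ALL distinct ranks `i, j, s`** — the three ranks are
  distinct, so `max(i,j,s) ≥ 2` and the particle condition is automatic; `perStep_labelled_T_le` (`T_n(j)` antitone in `ρ_s` whenever `max(j,s) ≥ 2`).

So CONJECTURE M′ (MEMO-gen37 §5b, OPEN-MATH (b′)) IS A THEOREM in the sorted (local) form used by chapter Y: per-step domination holds off the tag in every position; the violations found by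
the GEN-39 toy sit exactly at `{j,s} = {0,1}` (`T_n(1)` vs `ρ_0`, `T_n(0)` vs `ρ_1`), which no off-tag pair reads, and on the diagonal (Y5).  For the class chains of chapter W (an
adjacent pair's tagged chains lumped by content) the particle condition at `max(rank Z, rank w, rank ★)` holds automatically for three distinct classes, so the `j`-attempt hub-content
laws satisfy `y_j(w) ≤ x_j(w)` at every ordinary content `w` other than the start content — the per-step input of route (β).  TOY (`numerics/toy2.py`, `toy3.py`, `toy5.py`, exact
rationals, NOTHING CLAIMED): 0 ∕ 125 856 sorted and 0 ∕ ≈ 96 000 global (unsorted, crossing) off-tag checks.  Literature grade (cell rule): OWN, elementary; nothing cited; no new bib keys.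
-/

open Finset

namespace Summit.Ventures.LatticeQCDFlow.Scaling

/-! ### §1 Levels and eigenvalues of the two profiles -/
section Levels
variable {m : ℕ} {ρ N R M β a : ℕ → ℝ} {c : ℝ}

/-- `M` is non-increasing in the rank. [ours] -/
theorem perStep_M_anti (hN : ∀ i, 0 < N i) (hM : ∀ k, M k = ∑ i ∈ Ico k m, N i) {k l : ℕ} (hkl : k ≤ l) : M l ≤ M k := by
  rw [hM, hM]
  exact sum_le_sum_of_subset_of_nonneg (Ico_subset_Ico hkl le_rfl) fun i _ _ => (hN i).le

/-- **The level bound:** with `cM_0 ≤ 1 + c` and at least three particles at ranks `≤ k` (`M_{k+1} + 3 ≤ M_0`), `a_l ≥ 2c` for every `l ≥ k`. [ours] -/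
theorem perStep_level (hN : ∀ i, 0 < N i) (hM : ∀ k, M k = ∑ i ∈ Ico k m, N i) (ha : ∀ l, a l = 1 - c * M (l + 1)) (hc : 0 ≤ c)
    (hcK : c * M 0 ≤ 1 + c) {k l : ℕ} (h3 : M (k + 1) + 3 ≤ M 0) (hkl : k ≤ l) : 2 * c ≤ a l := by
  rw [ha]
  have hMl : M (l + 1) ≤ M (k + 1) := perStep_M_anti hN hM (by omega)
  nlinarith [mul_le_mul_of_nonneg_left hMl hc]

/-- `a_l + 2β_l ≥ 0` at such ranks (`β ≥ 1 − cM_0 ≥ −c`). [ours] -/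
theorem perStep_beta_level (hρ : ∀ i, 0 < ρ i) (hmono : Monotone ρ) (hN : ∀ i, 0 < N i) (hR : ∀ k, R k = ∑ i ∈ range k, N i * ρ i)
    (hM : ∀ k, M k = ∑ i ∈ Ico k m, N i) (hβ : ∀ k, β k = 1 - c * (M k + R k / ρ k)) (ha : ∀ l, a l = 1 - c * M (l + 1)) (hc : 0 ≤ c)
    (hcK : c * M 0 ≤ 1 + c) {k l : ℕ} (h3 : M (k + 1) + 3 ≤ M 0) (hkl : k ≤ l) (hl : l < m) : 0 ≤ a l + 2 * β l := by
  have h1 := perStep_level hN hM ha hc hcK h3 hkl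
  have h2 := hubClass_beta_ge hρ hmono hN hR hM hβ hc hl
  linarith

end Levels

/-! ### §2 Per-step domination for the class chain -/
section ClassDom
variable {m s : ℕ} {ρX ρY N RX RY M βX βY a : ℕ → ℝ} {c : ℝ} {PX PY fX fY : ℕ → ℕ → ℝ} {PnX PnY : ℕ → ℕ → ℕ → ℝ} {TX TY : ℕ → ℕ → ℝ}

/-- The shallower masses: `R^X_k ≤ R^Y_k` always, with equality for `k ≤ s`. [ours] -/
theorem perStep_R_le (hagree : ∀ i, i ≠ s → ρX i = ρY i) (htag : ρX s ≤ ρY s) (hN : ∀ i, 0 < N i)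
    (hRX : ∀ k, RX k = ∑ i ∈ range k, N i * ρX i) (hRY : ∀ k, RY k = ∑ i ∈ range k, N i * ρY i) (k : ℕ) : RX k ≤ RY k := by
  rw [hRX, hRY]
  refine sum_le_sum fun i _ => ?_
  by_cases his : i = s
  · rw [his]; exact mul_le_mul_of_nonneg_left htag (hN s).le
  · rw [hagree i his]

/-- `R^X_k = R^Y_k` for `k ≤ s`. [ours] -/
theorem perStep_R_eq (hagree : ∀ i, i ≠ s → ρX i = ρY i)
    (hRX : ∀ k, RX k = ∑ i ∈ range k, N i * ρX i) (hRY : ∀ k, RY k = ∑ i ∈ range k, N i * ρY i) {k : ℕ} (hks : k ≤ s) : RX k = RY k := by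
  rw [hRX, hRY]
  exact sum_congr rfl fun i hi => by rw [hagree i (by have := mem_range.mp hi; omega)]

/-- Deeper than the tag the eigenvalues FALL: `β^Y_l ≤ β^X_l` for `l > s` (`c ≥ 0`). [ours] -/
theorem perStep_beta_le (hρY : ∀ i, 0 < ρY i) (hagree : ∀ i, i ≠ s → ρX i = ρY i) (htag : ρX s ≤ ρY s) (hN : ∀ i, 0 < N i)
    (hRX : ∀ k, RX k = ∑ i ∈ range k, N i * ρX i) (hRY : ∀ k, RY k = ∑ i ∈ range k, N i * ρY i)
    (hβX : ∀ k, βX k = 1 - c * (M k + RX k / ρX k)) (hβY : ∀ k, βY k = 1 - c * (M k + RY k / ρY k)) (hc : 0 ≤ c)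
    {l : ℕ} (hsl : s < l) : βY l ≤ βX l := by
  rw [hβX, hβY, hagree l (by omega)]
  have h := div_le_div_of_nonneg_right (perStep_R_le hagree htag hN hRX hRY l) (hρY l).le
  nlinarith

/-- At the tag the eigenvalue RISES: `β^X_s ≤ β^Y_s` (`c ≥ 0`). [ours] -/
theorem perStep_beta_tag (hρX : ∀ i, 0 < ρX i) (hagree : ∀ i, i ≠ s → ρX i = ρY i) (htag : ρX s ≤ ρY s) (hN : ∀ i, 0 < N i)
    (hRX : ∀ k, RX k = ∑ i ∈ range k, N i * ρX i) (hRY : ∀ k, RY k = ∑ i ∈ range k, N i * ρY i)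
    (hβX : ∀ k, βX k = 1 - c * (M k + RX k / ρX k)) (hβY : ∀ k, βY k = 1 - c * (M k + RY k / ρY k)) (hc : 0 ≤ c) : βX s ≤ βY s := by
  rw [hβX, hβY, ← perStep_R_eq hagree hRX hRY le_rfl]
  have hR0 : 0 ≤ RX s := by rw [hRX]; exact sum_nonneg fun i _ => (mul_pos (hN i) (hρX i)).le
  have h : RX s / ρY s ≤ RX s / ρX s := div_le_div_of_nonneg_left hR0 (hρX s) htag
  nlinarith

/-- Shallower than the tag nothing moves: `β^X_l = β^Y_l` for `l < s`. [ours] -/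
theorem perStep_beta_eq (hagree : ∀ i, i ≠ s → ρX i = ρY i)
    (hRX : ∀ k, RX k = ∑ i ∈ range k, N i * ρX i) (hRY : ∀ k, RY k = ∑ i ∈ range k, N i * ρY i)
    (hβX : ∀ k, βX k = 1 - c * (M k + RX k / ρX k)) (hβY : ∀ k, βY k = 1 - c * (M k + RY k / ρY k)) {l : ℕ} (hls : l < s) : βX l = βY l := by
  rw [hβX, hβY, perStep_R_eq hagree hRX hRY hls.le, hagree l hls.ne]

/-- **DEEP TARGET (`s < j`), every `n`, no sign condition:** `T^Y_n(j) ≤ T^X_n(j)`. [ours] -/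
theorem perStep_T_le_deep (hρX : ∀ i, 0 < ρX i) (hρY : ∀ i, 0 < ρY i) (hmonoY : Monotone ρY)
    (hagree : ∀ i, i ≠ s → ρX i = ρY i) (htag : ρX s ≤ ρY s) (hN : ∀ i, 0 < N i)
    (hRX : ∀ k, RX k = ∑ i ∈ range k, N i * ρX i) (hRY : ∀ k, RY k = ∑ i ∈ range k, N i * ρY i) (hM : ∀ k, M k = ∑ i ∈ Ico k m, N i)
    (hβX : ∀ k, βX k = 1 - c * (M k + RX k / ρX k)) (hβY : ∀ k, βY k = 1 - c * (M k + RY k / ρY k)) (ha : ∀ l, a l = 1 - c * M (l + 1))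
    (hTX : ∀ n j, TX n j = (1 - βX j ^ n) / RX m + ∑ k ∈ Ico (j + 1) m, (1 / RX k - 1 / RX (k + 1)) * (βX k ^ n - βX j ^ n))
    (hTY : ∀ n j, TY n j = (1 - βY j ^ n) / RY m + ∑ k ∈ Ico (j + 1) m, (1 / RY k - 1 / RY (k + 1)) * (βY k ^ n - βY j ^ n))
    (hc : 0 ≤ c) (hcK : c * M 0 ≤ 1 + c) (n : ℕ) {j : ℕ} (hsj : s < j) (hj : j < m) (h3 : M (j + 1) + 3 ≤ M 0) : TY n j ≤ TX n j := by
  obtain ⟨H, hH⟩ : ∃ H : ℕ → ℝ → ℝ → ℝ, ∀ n x y, H n x y = ∑ t ∈ range n, x ^ t * y ^ (n - 1 - t) := ⟨_, fun _ _ _ => rfl⟩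
  obtain ⟨G, hG⟩ : ∃ G : ℕ → ℝ → ℝ → ℝ → ℝ, ∀ n a a' b, G n a a' b = ∑ q ∈ range (n - 1), a' ^ q * H (n - 1 - q) b a := ⟨_, fun _ _ _ _ => rfl⟩
  have hρj : ρX j = ρY j := hagree j (by omega)
  rw [hubClass_T_separable hρX hN hRX hM hβX ha hTX hH n hj, hubClass_T_separable hρY hN hRY hM hβY ha hTY hH n hj, ← hρj]
  have hal : ∀ l, j ≤ l → 2 * c ≤ a l := fun l hjl => perStep_level hN hM ha hc hcK h3 hjl
  have hapos : ∀ l, j ≤ l → 0 < a l := by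
    intro l hjl
    have := hal l hjl
    rcases hc.eq_or_lt with h0 | hpos
    · rw [ha, ← h0]; norm_num
    · linarith
  have hβYl : ∀ l, j ≤ l → l < m → 0 ≤ a l + 2 * βY l := fun l hjl hl => perStep_beta_level hρY hmonoY hN hRY hM hβY ha hc hcK h3 hjl hl
  have hβle : ∀ l, s < l → βY l ≤ βX l := fun l hsl => perStep_beta_le hρY hagree htag hN hRX hRY hβX hβY hc hsl
  -- the rank-`j` term
  have h1 : H n (βY j) (a j) ≤ H n (βX j) (a j) := sepH_mono hH n (hapos j le_rfl) (hβYl j le_rfl hj) (hβle j hsj)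
  -- the deeper terms, in the `G`-face
  have h2 : ∑ l ∈ Ico (j + 1) m, (1 / ρY l) * (H n (βY l) (a l) - H n (βY l) (a (l - 1)))
      ≤ ∑ l ∈ Ico (j + 1) m, (1 / ρX l) * (H n (βX l) (a l) - H n (βX l) (a (l - 1))) := by
    refine sum_le_sum fun l hl => ?_
    have hl' : j + 1 ≤ l ∧ l < m := by simpa using mem_Ico.mp hl
    rw [← hagree l (by omega), ← sepG_mul hH hG n (a l) (a (l - 1)) (βY l), ← sepG_mul hH hG n (a l) (a (l - 1)) (βX l), sep_a_step hM ha (by omega) hl'.2]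
    have ha' : 0 ≤ a (l - 1) := by linarith [hal (l - 1) (by omega)]
    have hGle := sepG_mono hH hG n (a' := a (l - 1)) (hapos l (by omega)) ha' (hβYl l (by omega) hl'.2) (hβle l (by omega))
    exact mul_le_mul_of_nonneg_left (mul_le_mul_of_nonneg_left hGle (mul_nonneg hc (hN l).le)) (div_nonneg zero_le_one (hρX l).le)
  have hcρ : 0 ≤ c * (1 / ρX j) := mul_nonneg hc (div_nonneg zero_le_one (hρX j).le)
  nlinarith [mul_le_mul_of_nonneg_left h1 hcρ, mul_le_mul_of_nonneg_left h2 hc]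

/-- **SHALLOW TARGET (`j < s`), every `n`, any position of the tag:** `T^Y_n(j) ≤ T^X_n(j)`. [ours] -/
theorem perStep_T_le_shallow (hρX : ∀ i, 0 < ρX i) (hmonoX : Monotone ρX) (hρY : ∀ i, 0 < ρY i) (hmonoY : Monotone ρY)
    (hagree : ∀ i, i ≠ s → ρX i = ρY i) (htag : ρX s ≤ ρY s) (hN : ∀ i, 0 < N i)
    (hRX : ∀ k, RX k = ∑ i ∈ range k, N i * ρX i) (hRY : ∀ k, RY k = ∑ i ∈ range k, N i * ρY i) (hM : ∀ k, M k = ∑ i ∈ Ico k m, N i)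
    (hβX : ∀ k, βX k = 1 - c * (M k + RX k / ρX k)) (hβY : ∀ k, βY k = 1 - c * (M k + RY k / ρY k)) (ha : ∀ l, a l = 1 - c * M (l + 1))
    (hTX : ∀ n j, TX n j = (1 - βX j ^ n) / RX m + ∑ k ∈ Ico (j + 1) m, (1 / RX k - 1 / RX (k + 1)) * (βX k ^ n - βX j ^ n))
    (hTY : ∀ n j, TY n j = (1 - βY j ^ n) / RY m + ∑ k ∈ Ico (j + 1) m, (1 / RY k - 1 / RY (k + 1)) * (βY k ^ n - βY j ^ n))
    (hc : 0 ≤ c) (hcK : c * M 0 ≤ 1 + c) (n : ℕ) {j : ℕ} (hjs : j < s) (hs : s < m) (h3 : M (s + 1) + 3 ≤ M 0) : TY n j ≤ TX n j := by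
  obtain ⟨H, hH⟩ : ∃ H : ℕ → ℝ → ℝ → ℝ, ∀ n x y, H n x y = ∑ t ∈ range n, x ^ t * y ^ (n - 1 - t) := ⟨_, fun _ _ _ => rfl⟩
  obtain ⟨G, hG⟩ : ∃ G : ℕ → ℝ → ℝ → ℝ → ℝ, ∀ n a a' b, G n a a' b = ∑ q ∈ range (n - 1), a' ^ q * H (n - 1 - q) b a := ⟨_, fun _ _ _ _ => rfl⟩
  have hj : j < m := hjs.trans hs
  rw [hubClass_T_separable hρX hN hRX hM hβX ha hTX hH n hj, hubClass_T_separable hρY hN hRY hM hβY ha hTY hH n hj,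
    ← hagree j hjs.ne, ← perStep_beta_eq hagree hRX hRY hβX hβY hjs]
  have hal : ∀ l, s ≤ l → 2 * c ≤ a l := fun l hsl => perStep_level hN hM ha hc hcK h3 hsl
  have hapos : ∀ l, s ≤ l → 0 < a l := by
    intro l hsl
    have := hal l hsl
    rcases hc.eq_or_lt with h0 | hpos
    · rw [ha, ← h0]; norm_num
    · linarith
  have hβYl : ∀ l, s ≤ l → l < m → 0 ≤ a l + 2 * βY l := fun l hsl hl => perStep_beta_level hρY hmonoY hN hRY hM hβY ha hc hcK h3 hsl hl
  have hβXl : ∀ l, s ≤ l → l < m → 0 ≤ a l + 2 * βX l := fun l hsl hl => perStep_beta_level hρX hmonoX hN hRX hM hβX ha hc hcK h3 hsl hl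
  have hβle : ∀ l, s < l → βY l ≤ βX l := fun l hsl => perStep_beta_le hρY hagree htag hN hRX hRY hβX hβY hc hsl
  -- split the rank sums at `s`
  have split : ∀ g : ℕ → ℝ, ∑ l ∈ Ico (j + 1) m, g l = ∑ l ∈ Ico (j + 1) s, g l + g s + ∑ l ∈ Ico (s + 1) m, g l := by
    intro g
    rw [← Finset.sum_Ico_consecutive g (by omega : j + 1 ≤ s) hs.le, Finset.sum_eq_sum_Ico_succ_bot hs]
    ring
  rw [split (fun l => (1 / ρY l) * (H n (βY l) (a l) - H n (βY l) (a (l - 1)))), split (fun l => (1 / ρX l) * (H n (βX l) (a l) - H n (βX l) (a (l - 1))))]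
  -- block below the tag: identical
  have hb1 : ∑ l ∈ Ico (j + 1) s, (1 / ρY l) * (H n (βY l) (a l) - H n (βY l) (a (l - 1)))
      = ∑ l ∈ Ico (j + 1) s, (1 / ρX l) * (H n (βX l) (a l) - H n (βX l) (a (l - 1))) := by
    refine sum_congr rfl fun l hl => ?_
    have hl' : j + 1 ≤ l ∧ l < s := by simpa using mem_Ico.mp hl
    rw [hagree l (by omega), perStep_beta_eq hagree hRX hRY hβX hβY hl'.2]
  -- the tag term, in the `R`-face (`R_s` is common; `β_s` rises, `−H_n(β_s,a_s)` falls)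
  have hs1 : 1 ≤ s := by omega
  have hface : ∀ {ρ R β : ℕ → ℝ}, (∀ i, 0 < ρ i) → (∀ k, R k = ∑ i ∈ range k, N i * ρ i) → (∀ k, β k = 1 - c * (M k + R k / ρ k)) → 0 < c →
      (1 / ρ s) * (H n (β s) (a s) - H n (β s) (a (s - 1))) = N s / R s * (H n (a (s - 1)) (a s) - H n (β s) (a s)) := by
    intro ρ R β hρ hR hβ hpos
    have h := hubClass_term_R hρ hN hR hM hβ ha hH n hs1 hs
    have h' : c * ((1 / ρ s) * (H n (β s) (a s) - H n (β s) (a (s - 1)))) = c * (N s / R s * (H n (a (s - 1)) (a s) - H n (β s) (a s))) := by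
      rw [← mul_assoc, h]; ring
    exact mul_left_cancel₀ hpos.ne' h'
  have hRs : RX s = RY s := perStep_R_eq hagree hRX hRY le_rfl
  have hRspos : 0 < RX s := by rw [hRX]; exact sum_pos (fun i _ => mul_pos (hN i) (hρX i)) ⟨0, mem_range.mpr (by omega)⟩
  have ht : (1 / ρY s) * (H n (βY s) (a s) - H n (βY s) (a (s - 1))) ≤ (1 / ρX s) * (H n (βX s) (a s) - H n (βX s) (a (s - 1))) := by
    rcases hc.eq_or_lt with h0 | hpos
    · -- `c = 0`: every level and every eigenvalue equals `1`, the term vanishes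
      have ha1 : ∀ l, a l = 1 := fun l => by rw [ha, ← h0]; ring
      have hβX0 : βX s = 1 := by rw [hβX, ← h0]; ring
      have hβY0 : βY s = 1 := by rw [hβY, ← h0]; ring
      rw [hβX0, hβY0, ha1 s, ha1 (s - 1), sub_self, mul_zero, mul_zero]
    rw [hface hρX hRX hβX hpos, hface hρY hRY hβY hpos, ← hRs]
    have hmono := sepH_mono hH n (hapos s le_rfl) (hβXl s le_rfl hs) (perStep_beta_tag hρX hagree htag hN hRX hRY hβX hβY hc)
    have hcoef : 0 ≤ N s / RX s := div_nonneg (hN s).le hRspos.le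
    nlinarith [mul_le_mul_of_nonneg_left hmono hcoef]
  -- block above the tag, in the `G`-face
  have hb3 : ∑ l ∈ Ico (s + 1) m, (1 / ρY l) * (H n (βY l) (a l) - H n (βY l) (a (l - 1)))
      ≤ ∑ l ∈ Ico (s + 1) m, (1 / ρX l) * (H n (βX l) (a l) - H n (βX l) (a (l - 1))) := by
    refine sum_le_sum fun l hl => ?_
    have hl' : s + 1 ≤ l ∧ l < m := by simpa using mem_Ico.mp hl
    rw [← hagree l (by omega), ← sepG_mul hH hG n (a l) (a (l - 1)) (βY l), ← sepG_mul hH hG n (a l) (a (l - 1)) (βX l), sep_a_step hM ha (by omega) hl'.2]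
    have ha' : 0 ≤ a (l - 1) := by linarith [hal (l - 1) (by omega)]
    have hGle := sepG_mono hH hG n (a' := a (l - 1)) (hapos l (by omega)) ha' (hβYl l (by omega) hl'.2) (hβle l (by omega))
    exact mul_le_mul_of_nonneg_left (mul_le_mul_of_nonneg_left hGle (mul_nonneg hc (hN l).le)) (div_nonneg zero_le_one (hρX l).le)
  rw [hb1]
  have hsum : ∑ l ∈ Ico (j + 1) s, (1 / ρX l) * (H n (βX l) (a l) - H n (βX l) (a (l - 1))) + (1 / ρY s) * (H n (βY s) (a s) - H n (βY s) (a (s - 1)))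
        + ∑ l ∈ Ico (s + 1) m, (1 / ρY l) * (H n (βY l) (a l) - H n (βY l) (a (l - 1)))
      ≤ ∑ l ∈ Ico (j + 1) s, (1 / ρX l) * (H n (βX l) (a l) - H n (βX l) (a (l - 1))) + (1 / ρX s) * (H n (βX s) (a s) - H n (βX s) (a (s - 1)))
        + ∑ l ∈ Ico (s + 1) m, (1 / ρX l) * (H n (βX l) (a l) - H n (βX l) (a (l - 1))) := by linarith
  linarith [mul_le_mul_of_nonneg_left hsum hc]

/-- **`T_n(j)` IS ANTITONE IN `ρ_s` FOR EVERY `s ≠ j` WITH THREE PARTICLES AT RANKS `≤ max(j,s)`.** [ours] -/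
theorem perStep_T_le (hρX : ∀ i, 0 < ρX i) (hmonoX : Monotone ρX) (hρY : ∀ i, 0 < ρY i) (hmonoY : Monotone ρY)
    (hagree : ∀ i, i ≠ s → ρX i = ρY i) (htag : ρX s ≤ ρY s) (hN : ∀ i, 0 < N i)
    (hRX : ∀ k, RX k = ∑ i ∈ range k, N i * ρX i) (hRY : ∀ k, RY k = ∑ i ∈ range k, N i * ρY i) (hM : ∀ k, M k = ∑ i ∈ Ico k m, N i)
    (hβX : ∀ k, βX k = 1 - c * (M k + RX k / ρX k)) (hβY : ∀ k, βY k = 1 - c * (M k + RY k / ρY k)) (ha : ∀ l, a l = 1 - c * M (l + 1))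
    (hTX : ∀ n j, TX n j = (1 - βX j ^ n) / RX m + ∑ k ∈ Ico (j + 1) m, (1 / RX k - 1 / RX (k + 1)) * (βX k ^ n - βX j ^ n))
    (hTY : ∀ n j, TY n j = (1 - βY j ^ n) / RY m + ∑ k ∈ Ico (j + 1) m, (1 / RY k - 1 / RY (k + 1)) * (βY k ^ n - βY j ^ n))
    (hc : 0 ≤ c) (hcK : c * M 0 ≤ 1 + c) (n : ℕ) {j : ℕ} (hjs : j ≠ s) (hj : j < m) (hs : s < m) (h3 : M (max j s + 1) + 3 ≤ M 0) : TY n j ≤ TX n j := by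
  rcases Nat.lt_or_gt_of_ne hjs with hlt | hgt
  · rw [max_eq_right hlt.le] at h3
    exact perStep_T_le_shallow hρX hmonoX hρY hmonoY hagree htag hN hRX hRY hM hβX hβY ha hTX hTY hc hcK n hlt hs h3
  · rw [max_eq_left hgt.le] at h3
    exact perStep_T_le_deep hρX hρY hmonoY hagree htag hN hRX hRY hM hβX hβY ha hTX hTY hc hcK n hgt hj h3

/-- **PER-STEP DOMINATION OFF THE TAG (class chain), every `n`, every position:** for ranks `i ≠ j`, both `≠ s`, with three particles at ranks `≤ max(i,j,s)`: `P_Yⁿ(i,j) ≤ P_Xⁿ(i,j)`. [ours] -/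
theorem perStep_pow_le (hρX : ∀ i, 0 < ρX i) (hmonoX : Monotone ρX) (hρY : ∀ i, 0 < ρY i) (hmonoY : Monotone ρY)
    (hagree : ∀ i, i ≠ s → ρX i = ρY i) (htag : ρX s ≤ ρY s) (hN : ∀ i, 0 < N i)
    (hRX : ∀ k, RX k = ∑ i ∈ range k, N i * ρX i) (hRY : ∀ k, RY k = ∑ i ∈ range k, N i * ρY i) (hM : ∀ k, M k = ∑ i ∈ Ico k m, N i)
    (hPXoff : ∀ i j, i ≠ j → PX i j = c * N j * min 1 (ρX j / ρX i)) (hPXdiag : ∀ i, PX i i = 1 - ∑ j ∈ (range m).erase i, PX i j)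
    (hPYoff : ∀ i j, i ≠ j → PY i j = c * N j * min 1 (ρY j / ρY i)) (hPYdiag : ∀ i, PY i i = 1 - ∑ j ∈ (range m).erase i, PY i j)
    (hfX : ∀ k i, fX k i = if i < k then ρX k else if i = k then -(RX k / N k) else 0)
    (hfY : ∀ k i, fY k i = if i < k then ρY k else if i = k then -(RY k / N k) else 0)
    (hβX : ∀ k, βX k = 1 - c * (M k + RX k / ρX k)) (hβY : ∀ k, βY k = 1 - c * (M k + RY k / ρY k)) (ha : ∀ l, a l = 1 - c * M (l + 1))
    (hPX0 : ∀ i j, PnX 0 i j = if i = j then 1 else 0) (hPXs : ∀ n i j, PnX (n + 1) i j = ∑ l ∈ range m, PnX n i l * PX l j)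
    (hPY0 : ∀ i j, PnY 0 i j = if i = j then 1 else 0) (hPYs : ∀ n i j, PnY (n + 1) i j = ∑ l ∈ range m, PnY n i l * PY l j)
    (hTX : ∀ n j, TX n j = (1 - βX j ^ n) / RX m + ∑ k ∈ Ico (j + 1) m, (1 / RX k - 1 / RX (k + 1)) * (βX k ^ n - βX j ^ n))
    (hTY : ∀ n j, TY n j = (1 - βY j ^ n) / RY m + ∑ k ∈ Ico (j + 1) m, (1 / RY k - 1 / RY (k + 1)) * (βY k ^ n - βY j ^ n))
    (hc : 0 ≤ c) (hcK : c * M 0 ≤ 1 + c) (n : ℕ) {i j : ℕ} (hi : i < m) (hj : j < m) (hs : s < m) (hij : i ≠ j) (his : i ≠ s) (hjs : j ≠ s)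
    (h3 : M (max (max i j) s + 1) + 3 ≤ M 0) : PnY n i j ≤ PnX n i j := by
  rw [hubClass_pow_offdiag hρX hmonoX hN hRX hM hPXoff hPXdiag hfX hβX hPX0 hPXs hTX n hi hj hij,
    hubClass_pow_offdiag hρY hmonoY hN hRY hM hPYoff hPYdiag hfY hβY hPY0 hPYs hTY n hi hj hij, ← hagree j hjs]
  have hms : max i j ≠ s := by
    rcases le_total i j with h | h
    · rwa [max_eq_right h]
    · rwa [max_eq_left h]
  have hT := perStep_T_le hρX hmonoX hρY hmonoY hagree htag hN hRX hRY hM hβX hβY ha hTX hTY hc hcK n hms (max_lt hi hj) hs h3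
  exact mul_le_mul_of_nonneg_left hT (mul_nonneg (hN j).le (hρX j).le)

/-- The diagonal at a start shallower than the tag (`i < s`, three particles at ranks `≤ s`): `P_Yⁿ(i,i) ≤ P_Xⁿ(i,i)` for every `n` (`β_i` does not move). [ours] -/
theorem perStep_pow_diag_le (hρX : ∀ i, 0 < ρX i) (hmonoX : Monotone ρX) (hρY : ∀ i, 0 < ρY i) (hmonoY : Monotone ρY)
    (hagree : ∀ i, i ≠ s → ρX i = ρY i) (htag : ρX s ≤ ρY s) (hN : ∀ i, 0 < N i)
    (hRX : ∀ k, RX k = ∑ i ∈ range k, N i * ρX i) (hRY : ∀ k, RY k = ∑ i ∈ range k, N i * ρY i) (hM : ∀ k, M k = ∑ i ∈ Ico k m, N i)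
    (hPXoff : ∀ i j, i ≠ j → PX i j = c * N j * min 1 (ρX j / ρX i)) (hPXdiag : ∀ i, PX i i = 1 - ∑ j ∈ (range m).erase i, PX i j)
    (hPYoff : ∀ i j, i ≠ j → PY i j = c * N j * min 1 (ρY j / ρY i)) (hPYdiag : ∀ i, PY i i = 1 - ∑ j ∈ (range m).erase i, PY i j)
    (hfX : ∀ k i, fX k i = if i < k then ρX k else if i = k then -(RX k / N k) else 0)
    (hfY : ∀ k i, fY k i = if i < k then ρY k else if i = k then -(RY k / N k) else 0)
    (hβX : ∀ k, βX k = 1 - c * (M k + RX k / ρX k)) (hβY : ∀ k, βY k = 1 - c * (M k + RY k / ρY k)) (ha : ∀ l, a l = 1 - c * M (l + 1))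
    (hPX0 : ∀ i j, PnX 0 i j = if i = j then 1 else 0) (hPXs : ∀ n i j, PnX (n + 1) i j = ∑ l ∈ range m, PnX n i l * PX l j)
    (hPY0 : ∀ i j, PnY 0 i j = if i = j then 1 else 0) (hPYs : ∀ n i j, PnY (n + 1) i j = ∑ l ∈ range m, PnY n i l * PY l j)
    (hTX : ∀ n j, TX n j = (1 - βX j ^ n) / RX m + ∑ k ∈ Ico (j + 1) m, (1 / RX k - 1 / RX (k + 1)) * (βX k ^ n - βX j ^ n))
    (hTY : ∀ n j, TY n j = (1 - βY j ^ n) / RY m + ∑ k ∈ Ico (j + 1) m, (1 / RY k - 1 / RY (k + 1)) * (βY k ^ n - βY j ^ n))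
    (hc : 0 ≤ c) (hcK : c * M 0 ≤ 1 + c) (n : ℕ) {i : ℕ} (his : i < s) (hs : s < m) (h3 : M (s + 1) + 3 ≤ M 0) : PnY n i i ≤ PnX n i i := by
  have hi : i < m := his.trans hs
  rw [hubClass_pow_diag hρX hmonoX hN hRX hM hPXoff hPXdiag hfX hβX hPX0 hPXs hTX n hi,
    hubClass_pow_diag hρY hmonoY hN hRY hM hPYoff hPYdiag hfY hβY hPY0 hPYs hTY n hi, ← hagree i his.ne,
    ← perStep_beta_eq hagree hRX hRY hβX hβY his]
  have hT := perStep_T_le_shallow hρX hmonoX hρY hmonoY hagree htag hN hRX hRY hM hβX hβY ha hTX hTY hc hcK n his hs h3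
  have := mul_le_mul_of_nonneg_left hT (mul_nonneg (hN i).le (hρX i).le)
  linarith

end ClassDom

/-! ### §3 The labelled chain: every triple of distinct ranks -/
section LabelledDom
variable {m s : ℕ} {ρX ρY RX RY βX βY : ℕ → ℝ} {c : ℝ} {PX PY fX fY : ℕ → ℕ → ℝ} {PnX PnY : ℕ → ℕ → ℕ → ℝ} {TX TY : ℕ → ℕ → ℝ}

/-- **`T_n(j)` antitone in `ρ_s` for the labelled chain whenever `max(j,s) ≥ 2`** (`c ≥ 0`, `c(m−1) ≤ 1`). [ours] -/
theorem perStep_labelled_T_le (hρX : ∀ i, 0 < ρX i) (hmonoX : Monotone ρX) (hρY : ∀ i, 0 < ρY i) (hmonoY : Monotone ρY)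
    (hagree : ∀ i, i ≠ s → ρX i = ρY i) (htag : ρX s ≤ ρY s)
    (hRX : ∀ k, RX k = ∑ i ∈ range k, ρX i) (hRY : ∀ k, RY k = ∑ i ∈ range k, ρY i)
    (hβX : ∀ k, βX k = 1 - c * (((m - k : ℕ) : ℝ) + RX k / ρX k)) (hβY : ∀ k, βY k = 1 - c * (((m - k : ℕ) : ℝ) + RY k / ρY k))
    (hTX : ∀ n j, TX n j = (1 - βX j ^ n) / RX m + ∑ k ∈ Ico (j + 1) m, (1 / RX k - 1 / RX (k + 1)) * (βX k ^ n - βX j ^ n))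
    (hTY : ∀ n j, TY n j = (1 - βY j ^ n) / RY m + ∑ k ∈ Ico (j + 1) m, (1 / RY k - 1 / RY (k + 1)) * (βY k ^ n - βY j ^ n))
    (hc : 0 ≤ c) (hcm : c * ((m : ℝ) - 1) ≤ 1) (n : ℕ) {j : ℕ} (hjs : j ≠ s) (hj : j < m) (hs : s < m) (h2 : 2 ≤ max j s) : TY n j ≤ TX n j := by
  have hRX' : ∀ k, RX k = ∑ i ∈ range k, (fun _ : ℕ => (1 : ℝ)) i * ρX i := fun k => by rw [hRX k]; simp
  have hRY' : ∀ k, RY k = ∑ i ∈ range k, (fun _ : ℕ => (1 : ℝ)) i * ρY i := fun k => by rw [hRY k]; simp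
  have hβX' : ∀ k, βX k = 1 - c * ((fun k => ((m - k : ℕ) : ℝ)) k + RX k / ρX k) := fun k => by rw [hβX k]
  have hβY' : ∀ k, βY k = 1 - c * ((fun k => ((m - k : ℕ) : ℝ)) k + RY k / ρY k) := fun k => by rw [hβY k]
  obtain ⟨a, ha⟩ : ∃ a : ℕ → ℝ, ∀ l, a l = 1 - c * (fun k => ((m - k : ℕ) : ℝ)) (l + 1) := ⟨_, fun _ => rfl⟩
  have hcK : c * (fun k => ((m - k : ℕ) : ℝ)) 0 ≤ 1 + c := by
    show c * (((m - 0 : ℕ) : ℝ)) ≤ 1 + c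
    rw [Nat.sub_zero]
    linarith [show c * ((m : ℝ) - 1) = c * m - c by ring]
  have h3 : (fun k => ((m - k : ℕ) : ℝ)) (max j s + 1) + 3 ≤ (fun k => ((m - k : ℕ) : ℝ)) 0 := by
    show (((m - (max j s + 1) : ℕ) : ℝ)) + 3 ≤ ((m - 0 : ℕ) : ℝ)
    have hmax : max j s < m := max_lt hj hs
    rw [Nat.sub_zero, Nat.cast_sub (by omega)]
    push_cast
    have : (2 : ℝ) ≤ max (j : ℝ) (s : ℝ) := by rw [← Nat.cast_max]; exact_mod_cast h2
    linarith
  exact perStep_T_le hρX hmonoX hρY hmonoY hagree htag (fun _ => one_pos) hRX' hRY' (fun k => sep_labelled_M m k) hβX' hβY' ha hTX hTY hc hcK n hjs hj hs h3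

/-- **CONJECTURE M′ FOR THE LABELLED CHAIN: per-step domination off the tag for ALL distinct ranks `i, j, s` and every `n`** (`c ≥ 0`, `c(m−1) ≤ 1`): `P_Yⁿ(i,j) ≤ P_Xⁿ(i,j)`. [ours] -/
theorem perStep_labelled_pow_le (hρX : ∀ i, 0 < ρX i) (hmonoX : Monotone ρX) (hρY : ∀ i, 0 < ρY i) (hmonoY : Monotone ρY)
    (hagree : ∀ i, i ≠ s → ρX i = ρY i) (htag : ρX s ≤ ρY s)
    (hRX : ∀ k, RX k = ∑ i ∈ range k, ρX i) (hRY : ∀ k, RY k = ∑ i ∈ range k, ρY i)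
    (hPXoff : ∀ i j, i ≠ j → PX i j = c * min 1 (ρX j / ρX i)) (hPXdiag : ∀ i, PX i i = 1 - ∑ j ∈ (range m).erase i, PX i j)
    (hPYoff : ∀ i j, i ≠ j → PY i j = c * min 1 (ρY j / ρY i)) (hPYdiag : ∀ i, PY i i = 1 - ∑ j ∈ (range m).erase i, PY i j)
    (hfX : ∀ k i, fX k i = if i < k then ρX k else if i = k then -RX k else 0) (hfY : ∀ k i, fY k i = if i < k then ρY k else if i = k then -RY k else 0)
    (hβX : ∀ k, βX k = 1 - c * (((m - k : ℕ) : ℝ) + RX k / ρX k)) (hβY : ∀ k, βY k = 1 - c * (((m - k : ℕ) : ℝ) + RY k / ρY k))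
    (hPX0 : ∀ i j, PnX 0 i j = if i = j then 1 else 0) (hPXs : ∀ n i j, PnX (n + 1) i j = ∑ l ∈ range m, PnX n i l * PX l j)
    (hPY0 : ∀ i j, PnY 0 i j = if i = j then 1 else 0) (hPYs : ∀ n i j, PnY (n + 1) i j = ∑ l ∈ range m, PnY n i l * PY l j)
    (hTX : ∀ n j, TX n j = (1 - βX j ^ n) / RX m + ∑ k ∈ Ico (j + 1) m, (1 / RX k - 1 / RX (k + 1)) * (βX k ^ n - βX j ^ n))
    (hTY : ∀ n j, TY n j = (1 - βY j ^ n) / RY m + ∑ k ∈ Ico (j + 1) m, (1 / RY k - 1 / RY (k + 1)) * (βY k ^ n - βY j ^ n))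
    (hc : 0 ≤ c) (hcm : c * ((m : ℝ) - 1) ≤ 1) (n : ℕ) {i j : ℕ} (hi : i < m) (hj : j < m) (hs : s < m) (hij : i ≠ j) (his : i ≠ s) (hjs : j ≠ s) :
    PnY n i j ≤ PnX n i j := by
  rw [hubChain_pow_offdiag hρX hmonoX hRX hPXoff hPXdiag hfX hβX hPX0 hPXs hTX n hi hj hij,
    hubChain_pow_offdiag hρY hmonoY hRY hPYoff hPYdiag hfY hβY hPY0 hPYs hTY n hi hj hij, ← hagree j hjs]
  have hms : max i j ≠ s := by
    rcases le_total i j with h | h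
    · rwa [max_eq_right h]
    · rwa [max_eq_left h]
  -- three distinct ranks: `max(i,j,s) ≥ 2`
  have h2 : 2 ≤ max (max i j) s := by
    rcases Nat.lt_or_gt_of_ne hij with h | h <;> rcases Nat.lt_or_gt_of_ne his with h' | h' <;> rcases Nat.lt_or_gt_of_ne hjs with h'' | h'' <;> omega
  have hT := perStep_labelled_T_le hρX hmonoX hρY hmonoY hagree htag hRX hRY hβX hβY hTX hTY hc hcm n hms (max_lt hi hj) hs h2
  exact mul_le_mul_of_nonneg_left hT (hρX j).le

end LabelledDom

end Summit.Ventures.LatticeQCDFlow.Scaling
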